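import Literature.Probability.Percolation.BoxArcStateReading
import Literature.Probability.Percolation.CrossingChains
import Literature.Probability.Percolation.FourArmGarbanSquareDomain
import Literature.Probability.LatticeModels.MeshDomainBulk
import Literature.Probability.Percolation.GluingRDE
import Literature.Probability.Percolation.MultiResTVSegments
import Literature.Probability.Percolation.PlanarDuality
import Literature.Probability.Percolation.RSWProofs
import Literature.Probability.Percolation.HalfPlaneArmAxisInputs
import Literature.Probability.Percolation.ZdNearCriticalWindow

/-!
# `stub_shadowingZ` is false (crux `GluingContraction`, line `birth` = `registered`), Part A: ties and the truth event

Crux `CardyGluingRDE.GluingContraction` (stmt-CriticalPhenomena-8580), line `birth` (served as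
`registered`, skeleton `Cruxes/GluingContraction/Lines/birth.lean`).  Its registered stub
`stub_shadowingZ` claims that the `m`-fold glued prediction `Ψ^m(lawZ@u)` shadows the true
bond-`ℤ²` reading law `lawZ@(u/2^m)` within `C·2^{-κK}`.  The three files of this directory refute
it: Part A (this file) and Part B (`BirthReadConnected`) are deterministic lattice geometry of bond
percolation read in the open unit square `sq 1 = (0,1)²` at a mesh `1/N`; Part C
(`BirthStubShadowingZFalse`) adds the probability estimates and proves the negation
`stub_shadowingZ_false` of the registered signature, verbatim.

This file:

* `tie_crossing` — the tie mechanism (the one that refuted `JunctionShadowing`, stmt-8581):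
  `discreteArc` compares distances with `≤`, so a boundary vertex one row inside the window whose
  mesh point is within `1/N` of two boundary pieces lies in BOTH discrete arcs, and
  `discreteCrossing` between the two pieces holds for EVERY configuration by the trivial path.
* `coord_of_mem_meshBoundary` — boundary vertices of the discretised open square have a
  coordinate in `{1, N-1}`; hence (`truth_subset`, the headline) the true crossing event "closed
  left side ↔ closed right side" at mesh `1/N`, `N ≥ 3`, is contained in the left-right crossing
  of the lattice square `(1,1) + [0,N-2]²`.
* `mem_seg0` … `mem_seg3` — coordinates of the `4k` boundary segments `seg 1 k` of the unit square.

Part B proves that every read state is primal-connected at the commensurable meshes `1/(n k)`.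
-/

namespace Summit.CriticalPhenomena.CardyFormulaZ2.Theorems

namespace StubShadowingZ

open Set Metric MeasureTheory Complex
open Literature.Probability.Percolation Literature.Probability.LatticeModels

/-! ### The open unit square and its discretisation at mesh `1/N` -/

/-- The reading window `sq 1` is the open unit square. [folklore] -/
theorem sq_one : Literature.Probability.Percolation.sq 1 = (Set.Ioo 0 1 ×ℂ Set.Ioo 0 1) := by
  ext z
  simp only [Literature.Probability.Percolation.sq, mem_reProdIm, mem_setOf_eq, mem_Ioo]
  tauto

/-- Mesh vertices of an open rectangle, in coordinates. [folklore] -/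
theorem mem_meshVertices_openRect {a b c d δ : ℝ} {x : Site 2} :
    x ∈ meshVertices (Set.Ioo a b ×ℂ Set.Ioo c d) δ ↔
      (a < δ * x 0 ∧ δ * x 0 < b) ∧ (c < δ * x 1 ∧ δ * x 1 < d) := by
  simp [mem_reProdIm]

/-- The rectangle spanned by two mesh vertices of an open rectangle stays inside it. [folklore] -/
theorem rectangle_subset_openRect {a b c d δ : ℝ} {x y : Site 2}
    (hx : x ∈ meshVertices (Set.Ioo a b ×ℂ Set.Ioo c d) δ) (hy : y ∈ meshVertices (Set.Ioo a b ×ℂ Set.Ioo c d) δ) :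
    Rectangle (meshPoint δ x) (meshPoint δ y) ⊆ (Set.Ioo a b ×ℂ Set.Ioo c d) := by
  intro z hz
  have hx' := mem_meshVertices_openRect.1 hx
  have hy' := mem_meshVertices_openRect.1 hy
  rw [Rectangle, mem_reProdIm, meshPoint_re, meshPoint_re, meshPoint_im, meshPoint_im] at hz
  exact ⟨(ordConnected_Ioo.uIcc_subset ⟨hx'.1.1, hx'.1.2⟩ ⟨hy'.1.1, hy'.1.2⟩) hz.1,
    (ordConnected_Ioo.uIcc_subset ⟨hx'.2.1, hx'.2.2⟩ ⟨hy'.2.1, hy'.2.2⟩) hz.2⟩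

/-- The mesh graph of an open rectangle is connected (staircase lemma), so the discrete domain is
the whole set of mesh vertices. [folklore] -/
theorem meshDomain_openRect (a b c d : ℝ) {δ : ℝ} (hδ : 0 < δ) :
    meshDomain (Set.Ioo a b ×ℂ Set.Ioo c d) δ = meshVertices (Set.Ioo a b ×ℂ Set.Ioo c d) δ := by
  refine meshDomain_eq_meshVertices_of_preconnected ?_
  rintro ⟨x, hx⟩ ⟨y, hy⟩
  exact meshVertexGraph_reachable_of_rectangle_subset hδ _ x y rfl (rectangle_subset_openRect hx hy)
    hx hy

/-- Integer coordinates of the mesh vertices of the unit square at mesh `1/N`. [folklore] -/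
theorem mem_meshVertices_unitSq {N : ℕ} (hN : 0 < N) {v : Site 2} :
    v ∈ meshVertices (Set.Ioo 0 1 ×ℂ Set.Ioo 0 1) (N : ℝ)⁻¹ ↔
      (0 < v 0 ∧ v 0 < (N : ℤ)) ∧ (0 < v 1 ∧ v 1 < (N : ℤ)) := by
  have hN' : (0 : ℝ) < N := by exact_mod_cast hN
  have key : ∀ t : ℤ, (0 < (N : ℝ)⁻¹ * t ∧ (N : ℝ)⁻¹ * t < 1) ↔ (0 < t ∧ t < (N : ℤ)) := fun t => by
    rw [← div_eq_inv_mul, lt_div_iff₀ hN', div_lt_iff₀ hN', zero_mul, one_mul]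
    exact ⟨fun h => ⟨by exact_mod_cast h.1, by exact_mod_cast h.2⟩,
      fun h => ⟨by exact_mod_cast h.1, by exact_mod_cast h.2⟩⟩
  rw [mem_meshVertices_openRect, key, key]

/-- **Boundary vertices of the discretised open unit square** at mesh `1/N` have a coordinate in
`{1, N-1}`: every other `ℤ²`-neighbour of a vertex is a mesh vertex joined to it by a closed edge
inside the (convex) window. [folklore] -/
theorem coord_of_mem_meshBoundary {N : ℕ} (hN : 0 < N) {x : Site 2}
    (hx : x ∈ meshBoundary (Set.Ioo 0 1 ×ℂ Set.Ioo 0 1) (N : ℝ)⁻¹) :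
    ((0 < x 0 ∧ x 0 < (N : ℤ)) ∧ (0 < x 1 ∧ x 1 < (N : ℤ))) ∧
      (x 0 = 1 ∨ x 0 = (N : ℤ) - 1 ∨ x 1 = 1 ∨ x 1 = (N : ℤ) - 1) := by
  have ht0 : (0 : ℝ) < (N : ℝ)⁻¹ := inv_pos.2 (by exact_mod_cast hN)
  have hD := meshDomain_openRect 0 1 0 1 ht0
  obtain ⟨hxD, y, hxy, hny⟩ := hx
  rw [hD] at hxD
  have hxV := (mem_meshVertices_unitSq hN).1 hxD
  refine ⟨hxV, ?_⟩
  have hyV : y ∉ meshVertices (Set.Ioo 0 1 ×ℂ Set.Ioo 0 1) (N : ℝ)⁻¹ := by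
    intro hyV
    refine hny (discreteDomainGraph_adj_iff.2 ⟨meshGraph_adj_iff.2 ⟨hxy, ?_⟩, ?_, ?_⟩)
    · exact ((convex_rectangle _ _).segment_subset (left_mem_rectangle _ _)
        (right_mem_rectangle _ _)).trans ((rectangle_subset_openRect hxD hyV).trans subset_closure)
    · rw [hD]; exact hxD
    · rw [hD]; exact hyV
  rw [mem_meshVertices_unitSq hN] at hyV
  rw [zdGraph_adj_iff] at hxy
  obtain ⟨i, h | h⟩ := hxy
  · have h0 := congrFun h 0
    have h1 := congrFun h 1
    fin_cases i <;> simp at h0 h1 <;> omega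
  · have h0 := congrFun h 0
    have h1 := congrFun h 1
    fin_cases i <;> simp at h0 h1 <;> omega

/-- A mesh vertex of the unit square with a coordinate in `{1, N-1}` is a boundary vertex.
[folklore] -/
theorem mem_meshBoundary_unitSq {N : ℕ} (hN : 0 < N) {P : Site 2}
    (hP : (0 < P 0 ∧ P 0 < (N : ℤ)) ∧ (0 < P 1 ∧ P 1 < (N : ℤ)))
    (hb : P 0 = 1 ∨ P 0 = (N : ℤ) - 1 ∨ P 1 = 1 ∨ P 1 = (N : ℤ) - 1) :
    P ∈ meshBoundary (Set.Ioo 0 1 ×ℂ Set.Ioo 0 1) (N : ℝ)⁻¹ := by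
  have ht0 : (0 : ℝ) < (N : ℝ)⁻¹ := inv_pos.2 (by exact_mod_cast hN)
  have hD := meshDomain_openRect 0 1 0 1 ht0
  have hV : ∀ v : Site 2, v ∈ meshDomain (Set.Ioo 0 1 ×ℂ Set.Ioo 0 1) (N : ℝ)⁻¹ ↔
      (0 < v 0 ∧ v 0 < (N : ℤ)) ∧ (0 < v 1 ∧ v 1 < (N : ℤ)) := fun v => by
    rw [hD, mem_meshVertices_unitSq hN]
  have out : ∀ (i : Fin 2) (s : ℤ), s = 1 ∨ s = -1 →
      ¬ ((0 < (P + Pi.single i s : Site 2) 0 ∧ (P + Pi.single i s : Site 2) 0 < (N : ℤ)) ∧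
          (0 < (P + Pi.single i s : Site 2) 1 ∧ (P + Pi.single i s : Site 2) 1 < (N : ℤ))) →
      P ∈ meshBoundary (Set.Ioo 0 1 ×ℂ Set.Ioo 0 1) (N : ℝ)⁻¹ := fun i s hs h =>
    mem_meshBoundary_of_adj_not_mem ((hV P).2 hP) (zdGraph_adj_add_single P i hs)
      (fun hm => h ((hV _).1 hm))
  rcases hb with h | h | h | h
  · exact out 0 (-1) (Or.inr rfl) (by simp; omega)
  · exact out 0 1 (Or.inl rfl) (by simp; omega)
  · exact out 1 (-1) (Or.inr rfl) (by simp; omega)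
  · exact out 1 1 (Or.inl rfl) (by simp; omega)

/-- Points of the four closed sides are frontier points of the open unit square. [folklore] -/
theorem mem_frontier_unitSq {z : ℂ}
    (h : ((0 ≤ z.re ∧ z.re ≤ 1) ∧ (z.im = 0 ∨ z.im = 1)) ∨
      ((z.re = 0 ∨ z.re = 1) ∧ (0 ≤ z.im ∧ z.im ≤ 1))) :
    z ∈ frontier (Set.Ioo 0 1 ×ℂ Set.Ioo 0 1) := by
  rw [frontier_reProdIm, closure_Ioo zero_ne_one, frontier_Ioo zero_lt_one]
  rcases h with ⟨hre, him⟩ | ⟨hre, him⟩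
  · exact Or.inl ⟨hre, by rcases him with h | h <;> simp [h]⟩
  · exact Or.inr ⟨by rcases hre with h | h <;> simp [h], him⟩

/-- Lower bound for `infDist` to a nonempty set. [folklore] -/
theorem le_infDist_of_forall' {x : ℂ} {s : Set ℂ} {r : ℝ} (hs : s.Nonempty)
    (h : ∀ y ∈ s, r ≤ dist x y) : r ≤ infDist x s :=
  (le_infDist hs).2 fun _ hy => h _ hy

/-- A point at sup-distance `≥ t` inside the unit square is at distance `≥ t` from its frontier
(frontier points lie on the four side lines). [folklore] -/
theorem le_dist_of_mem_frontier {t : ℝ} {p : ℂ} (h1 : t ≤ p.re) (h2 : p.re ≤ 1 - t)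
    (h3 : t ≤ p.im) (h4 : p.im ≤ 1 - t) : ∀ z ∈ frontier (Set.Ioo 0 1 ×ℂ Set.Ioo 0 1), t ≤ dist p z := by
  intro z hz
  have hre : |p.re - z.re| ≤ dist p z := by rw [dist_eq_norm]; exact abs_re_sub_le_norm_sub p z
  have him : |p.im - z.im| ≤ dist p z := by rw [dist_eq_norm]; simpa using abs_im_le_norm (p - z)
  rw [frontier_reProdIm, frontier_Ioo zero_lt_one] at hz
  simp only [mem_union, mem_reProdIm, mem_insert_iff, mem_singleton_iff] at hz
  rcases hz with ⟨-, h | h⟩ | ⟨h | h, -⟩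
  · exact (le_abs.2 (Or.inl (by rw [h]; linarith))).trans him
  · exact (le_abs.2 (Or.inr (by rw [h]; linarith))).trans him
  · exact (le_abs.2 (Or.inl (by rw [h]; linarith))).trans hre
  · exact (le_abs.2 (Or.inr (by rw [h]; linarith))).trans hre

/-! ### The tie mechanism -/

/-- **Tie criterion.** At mesh `1/N` let `P = (i, j)` be a lattice vertex of the open unit square
with mesh point `(x, y)` at sup-distance `≥ 1/N` from the frontier and with a coordinate in
`{1, N-1}` (a boundary vertex). Then `P` lies in the discrete arc of EVERY boundary piece that
comes within `1/N` of `(x, y)` and misses some frontier point (`discreteArc` compares with `≤`),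
so any two such pieces `A`, `B` are `discreteCrossing`-joined for EVERY configuration `ω`, by the
trivial path at `P`. [folklore] -/
theorem tie_crossing {N : ℕ} (hN : 0 < N) {i j : ℤ} {x y : ℝ}
    (hx : (N : ℝ)⁻¹ * i = x) (hy : (N : ℝ)⁻¹ * j = y)
    (h1 : (N : ℝ)⁻¹ ≤ x) (h2 : x ≤ 1 - (N : ℝ)⁻¹) (h3 : (N : ℝ)⁻¹ ≤ y) (h4 : y ≤ 1 - (N : ℝ)⁻¹)
    (hb : i = 1 ∨ i = (N : ℤ) - 1 ∨ j = 1 ∨ j = (N : ℤ) - 1)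
    {A B : Set ℂ} {zA wA zB wB : ℂ}
    (hzA : zA ∈ A) (hdA : dist (⟨x, y⟩ : ℂ) zA ≤ (N : ℝ)⁻¹)
    (hwA : wA ∈ frontier (Set.Ioo 0 1 ×ℂ Set.Ioo 0 1)) (hwA' : wA ∉ A)
    (hzB : zB ∈ B) (hdB : dist (⟨x, y⟩ : ℂ) zB ≤ (N : ℝ)⁻¹)
    (hwB : wB ∈ frontier (Set.Ioo 0 1 ×ℂ Set.Ioo 0 1)) (hwB' : wB ∉ B)
    (ω : BondConfig (Site 2)) :
    ω ∈ discreteCrossing (Set.Ioo 0 1 ×ℂ Set.Ioo 0 1) (N : ℝ)⁻¹ A B := by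
  have ht0 : (0 : ℝ) < (N : ℝ)⁻¹ := inv_pos.2 (by exact_mod_cast hN)
  have hmp : meshPoint (N : ℝ)⁻¹ ![i, j] = ⟨x, y⟩ := by
    apply Complex.ext <;> simp [meshPoint_re, meshPoint_im, hx, hy]
  have hPV : (![i, j] : Site 2) ∈ meshVertices (Set.Ioo 0 1 ×ℂ Set.Ioo 0 1) (N : ℝ)⁻¹ := by
    rw [mem_meshVertices_iff, hmp]
    exact ⟨⟨by show (0 : ℝ) < x; linarith, by show x < 1; linarith⟩,
      by show (0 : ℝ) < y; linarith, by show y < 1; linarith⟩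
  have hbd : (![i, j] : Site 2) ∈ meshBoundary (Set.Ioo 0 1 ×ℂ Set.Ioo 0 1) (N : ℝ)⁻¹ :=
    mem_meshBoundary_unitSq hN ((mem_meshVertices_unitSq hN).1 hPV) (by simpa using hb)
  have hfar : ∀ C : Set ℂ, ∀ w ∈ frontier (Set.Ioo 0 1 ×ℂ Set.Ioo 0 1), w ∉ C →
      (N : ℝ)⁻¹ ≤ infDist (⟨x, y⟩ : ℂ) (frontier (Set.Ioo 0 1 ×ℂ Set.Ioo 0 1) \ C) := fun C w hw hwC =>
    le_infDist_of_forall' ⟨w, hw, hwC⟩ fun z hz =>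
      le_dist_of_mem_frontier (p := ⟨x, y⟩) h1 h2 h3 h4 z hz.1
  refine ⟨![i, j], ⟨hbd, ?_⟩, ![i, j], ⟨hbd, ?_⟩, SimpleGraph.Reachable.refl _⟩
  · rw [hmp]
    exact ((infDist_le_dist_of_mem hzA).trans hdA).trans (hfar A wA hwA hwA')
  · rw [hmp]
    exact ((infDist_le_dist_of_mem hzB).trans hdB).trans (hfar B wB hwB hwB')

/-! ### Towards T2: the truth is a long box crossing -/

/-- The support of a walk of `G ⊓ H` lies in any set containing the start and all `H`-neighbours.
[folklore] -/
theorem support_subset_of_walk {V : Type*} {G H : SimpleGraph V} {S : Set V}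
    (hH : ∀ a b, H.Adj a b → b ∈ S) {x y : V} (p : (G ⊓ H).Walk x y) (hx : x ∈ S) :
    ∀ z ∈ p.support, z ∈ S := by
  induction p with
  | nil => simpa using hx
  | cons h p ih => simpa [hx] using ih (hH _ _ ((SimpleGraph.inf_adj _ _ _ _).1 h).2)

/-- A vertex of the discrete arc of a vertical side `{re = s}` of the unit square is no farther
from it than from the bottom and from the top: `|x₀/N - s| ≤ x₁/N` and `|x₀/N - s| ≤ 1 - x₁/N`.
[folklore] -/
theorem arc_side_bounds {N : ℕ} {s : ℝ} {x : Site 2}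
    (hx : x ∈ discreteArc (Set.Ioo 0 1 ×ℂ Set.Ioo 0 1) (N : ℝ)⁻¹ {z : ℂ | z.re = s ∧ 0 ≤ z.im ∧ z.im ≤ 1})
    (hne : (N : ℝ)⁻¹ * x 0 ≠ s) :
    |(N : ℝ)⁻¹ * x 0 - s| ≤ (N : ℝ)⁻¹ * x 1 ∧ |(N : ℝ)⁻¹ * x 0 - s| ≤ 1 - (N : ℝ)⁻¹ * x 1 := by
  obtain ⟨hxB, hdist⟩ := hx
  obtain ⟨⟨h1, h2⟩, h3, h4⟩ :=
    mem_meshVertices_openRect.1 (meshDomain_subset_meshVertices _ _ hxB.1)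
  have hlow : |(N : ℝ)⁻¹ * x 0 - s| ≤
      infDist (meshPoint (N : ℝ)⁻¹ x) {z : ℂ | z.re = s ∧ 0 ≤ z.im ∧ z.im ≤ 1} :=
    le_infDist_of_forall' ⟨⟨s, 0⟩, rfl, le_rfl, zero_le_one⟩ fun z hz =>
      calc |(N : ℝ)⁻¹ * x 0 - s| = |(meshPoint (N : ℝ)⁻¹ x).re - z.re| := by
            rw [meshPoint_re, hz.1]
        _ ≤ ‖meshPoint (N : ℝ)⁻¹ x - z‖ := abs_re_sub_le_norm_sub _ _
        _ = dist _ z := (dist_eq_norm _ _).symm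
  have hF : ∀ t : ℝ, t = 0 ∨ t = 1 → (⟨(N : ℝ)⁻¹ * x 0, t⟩ : ℂ) ∈
      frontier (Set.Ioo 0 1 ×ℂ Set.Ioo 0 1) \ {z : ℂ | z.re = s ∧ 0 ≤ z.im ∧ z.im ≤ 1} := fun t ht =>
    ⟨mem_frontier_unitSq (Or.inl ⟨⟨h1.le, h2.le⟩, ht⟩), fun h => hne h.1⟩
  have hd : ∀ t : ℝ, dist (meshPoint (N : ℝ)⁻¹ x) ⟨(N : ℝ)⁻¹ * x 0, t⟩ = |(N : ℝ)⁻¹ * x 1 - t| :=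
    fun t => by rw [dist_of_re_eq (by simp [meshPoint_re]), Real.dist_eq, meshPoint_im]
  refine ⟨hlow.trans (hdist.trans ((infDist_le_dist_of_mem (hF 0 (Or.inl rfl))).trans_eq ?_)),
    hlow.trans (hdist.trans ((infDist_le_dist_of_mem (hF 1 (Or.inr rfl))).trans_eq ?_))⟩
  · rw [hd, sub_zero, abs_of_pos h3]
  · rw [hd, abs_sub_comm, abs_of_pos (by linarith)]

/-- **Truth forces a long box crossing.** At mesh `1/N`, `N ≥ 3`, an open crossing of the
discretised unit square from the discrete arc of its closed left side to that of its closed right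
side is an open left-right crossing of the lattice square `(1,1) + [0, N-2]²`: by
`coord_of_mem_meshBoundary` and `arc_side_bounds` the two arcs are the columns `x₀ = 1`,
`x₀ = N - 1`. [folklore] -/
theorem truth_subset : ∀ {N : ℕ}, 3 ≤ N → discreteCrossing (Set.Ioo 0 1 ×ℂ Set.Ioo 0 1) (N : ℝ)⁻¹ {z : ℂ | z.re = 0 ∧ 0 ≤ z.im ∧ z.im ≤ 1} {z : ℂ | z.re = 1 ∧ 0 ≤ z.im ∧ z.im ≤ 1} ⊆ lrCrossingAt ![1, 1] (N - 2) (N - 2) := by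
  rintro N hN ω ⟨x, hx, y, hy, hr⟩
  have hN0 : 0 < N := by omega
  have hN' : (0 : ℝ) < N := by exact_mod_cast hN0
  have ht0 : (0 : ℝ) < (N : ℝ)⁻¹ := inv_pos.2 hN'
  obtain ⟨⟨⟨hx0, hx0'⟩, hx1, hx1'⟩, hxb⟩ := coord_of_mem_meshBoundary hN0 hx.1
  obtain ⟨⟨⟨hy0, hy0'⟩, hy1, hy1'⟩, hyb⟩ := coord_of_mem_meshBoundary hN0 hy.1
  -- the left arc is the column `x₀ = 1`
  have hxcol : x 0 = 1 := by
    have hpos : (0 : ℝ) < (N : ℝ)⁻¹ * x 0 := mul_pos ht0 (by exact_mod_cast hx0)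
    obtain ⟨ha, hb⟩ := arc_side_bounds hx hpos.ne'
    rw [sub_zero, abs_of_pos hpos] at ha hb
    have k1 : x 0 ≤ x 1 := by exact_mod_cast le_of_mul_le_mul_left ha ht0
    have k2 : x 0 + x 1 ≤ (N : ℤ) := by
      have : (N : ℝ)⁻¹ * ((x 0 : ℝ) + x 1) ≤ (N : ℝ)⁻¹ * N := by
        rw [inv_mul_cancel₀ hN'.ne', mul_add]; linarith
      exact_mod_cast le_of_mul_le_mul_left this ht0
    omega
  -- the right arc is the column `x₀ = N - 1`
  have hycol : y 0 = (N : ℤ) - 1 := by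
    have hlt : (N : ℝ)⁻¹ * y 0 < 1 := by
      have : ((y 0 : ℤ) : ℝ) < N := by exact_mod_cast hy0'
      rw [inv_mul_lt_iff₀ hN']; linarith
    obtain ⟨ha, hb⟩ := arc_side_bounds hy hlt.ne
    rw [abs_sub_comm, abs_of_pos (sub_pos.2 hlt)] at ha hb
    have k1 : (N : ℤ) ≤ y 0 + y 1 := by
      have : (N : ℝ)⁻¹ * N ≤ (N : ℝ)⁻¹ * ((y 0 : ℝ) + y 1) := by
        rw [inv_mul_cancel₀ hN'.ne', mul_add]; linarith
      exact_mod_cast le_of_mul_le_mul_left this ht0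
    have k2 : y 1 ≤ y 0 := by
      have : (N : ℝ)⁻¹ * ((y 1 : ℤ) : ℝ) ≤ (N : ℝ)⁻¹ * ((y 0 : ℤ) : ℝ) := by linarith
      exact_mod_cast le_of_mul_le_mul_left this ht0
    omega
  -- the open path as an open connection inside the lattice square `(1,1) + [0,N-2]²`
  have hD := meshDomain_openRect 0 1 0 1 ht0
  obtain ⟨p⟩ := hr
  have hsupp : ∀ z ∈ p.support, z ∈ meshVertices (Set.Ioo 0 1 ×ℂ Set.Ioo 0 1) (N : ℝ)⁻¹ :=
    support_subset_of_walk (S := meshVertices (Set.Ioo 0 1 ×ℂ Set.Ioo 0 1) (N : ℝ)⁻¹)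
      (fun a b hab => by rw [← hD]; exact (discreteDomainGraph_adj_iff.1 hab).2.2) p
      (meshDomain_subset_meshVertices _ _ hx.1.1)
  have hedges : ∀ e ∈ p.edges, e ∈ ω ∩ (zdGraph 2).edgeSet := fun e he => by
    have h' := p.edges_subset_edgeSet he
    rw [SimpleGraph.edgeSet_inf] at h'
    exact ⟨edgeSet_openGraph_subset ω h'.1, SimpleGraph.edgeSet_mono
      ((discreteDomainGraph_le_meshGraph _ _).trans (meshGraph_le_zdGraph _ _)) h'.2⟩
  have hrect : meshVertices (Set.Ioo 0 1 ×ℂ Set.Ioo 0 1) (N : ℝ)⁻¹ ⊆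
      (· + ![(1 : ℤ), 1]) '' (rectangle (N - 2) (N - 2) : Set (Site 2)) := fun v hv => by
    have h := (mem_meshVertices_unitSq hN0).1 hv
    rw [mem_image_rectangle_iff]
    simp only [Matrix.cons_val_zero, Matrix.cons_val_one]
    omega
  have hconn := mem_openConnIn_of_walk p (fun z hz => hrect (hsupp z hz)) hedges
  refine isUpperSet_lrCrossingAt _ _ _ (inter_subset_left (s := ω) (t := (zdGraph 2).edgeSet))
    ⟨x, ⟨x - ![1, 1], ?_, sub_add_cancel _ _⟩, y, ⟨y - ![1, 1], ?_, sub_add_cancel _ _⟩, hconn⟩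
  · simp only [Finset.mem_coe, leftSide, Finset.mem_filter, mem_rectangle_iff, Pi.sub_apply,
      Matrix.cons_val_zero, Matrix.cons_val_one]
    omega
  · simp only [Finset.mem_coe, rightSide, Finset.mem_filter, mem_rectangle_iff, Pi.sub_apply,
      Matrix.cons_val_zero, Matrix.cons_val_one]
    omega


/-! ### The boundary segments at the commensurable mesh `1/(n k)` -/

/-- Bottom segments (coordinate position `t`): `im = 0`, `t/k ≤ re ≤ (t+1)/k`. [folklore] -/
theorem mem_seg0 {k : ℕ} {t : Fin k} {z : ℂ} : z ∈ seg 1 k ((0 : Fin 4), t) ↔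
    z.im = 0 ∧ (t : ℝ) / k ≤ z.re ∧ z.re ≤ ((t : ℝ) + 1) / k := by
  simp [seg]

/-- Right segments: `re = 1`, `t/k ≤ im ≤ (t+1)/k`. [folklore] -/
theorem mem_seg1 {k : ℕ} {t : Fin k} {z : ℂ} : z ∈ seg 1 k ((1 : Fin 4), t) ↔
    z.re = 1 ∧ (t : ℝ) / k ≤ z.im ∧ z.im ≤ ((t : ℝ) + 1) / k := by
  simp [seg]

/-- Top segments (coordinate position `t`, by `re`): `im = 1`, `t/k ≤ re ≤ (t+1)/k`. [folklore] -/
theorem mem_seg2 {k : ℕ} {t : Fin k} {z : ℂ} : z ∈ seg 1 k ((2 : Fin 4), t) ↔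
    z.im = 1 ∧ (t : ℝ) / k ≤ z.re ∧ z.re ≤ ((t : ℝ) + 1) / k := by
  simp [seg]

/-- Left segments (coordinate position `t`, by `im`): `re = 0`, `t/k ≤ im ≤ (t+1)/k`. [folklore] -/
theorem mem_seg3 {k : ℕ} {t : Fin k} {z : ℂ} : z ∈ seg 1 k ((3 : Fin 4), t) ↔
    z.re = 0 ∧ (t : ℝ) / k ≤ z.im ∧ z.im ≤ ((t : ℝ) + 1) / k := by
  simp [seg]

end StubShadowingZ

end Summit.CriticalPhenomena.CardyFormulaZ2.Theorems
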